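import Summits.NavierStokesRegularity.NavierStokesRegularity.Theorems.AdaptedFrequencyAdaptedKernelExistsUpperOfMoments
import Summits.NavierStokesRegularity.NavierStokesRegularity.Theorems.AdaptedFrequencyAdaptedKernelExistsLowerOfUpper

/-!
# Crux `AdaptedKernelExists` (stmt-NavierStokesRegularity-2956), line `nash-entropy-last-block`:
  the a-priori two-sided Gaussian comparability on the last block

Helper file (lands `--supports stmt-NavierStokesRegularity-2956`): the two a-priori stubs of the
line combined.  For `ν > 0`, `C ≥ 0` there are constants `c₁, c₂, C₁, C₂ > 0` (depending on
`(ν, C)` only) such that every adapted backward kernel of a smooth divergence-free Type-I drift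
`‖b(t,x)‖ ≤ C/√(T−t)` on `Ico t₀ T` which has SOME Gaussian envelope and obeys the exponential
moment law of `stub_expMoment` is two-sided Gaussian comparable on `Ioo t₀ T` with these constants:
the upper bound is `stub_upperOfMoments` (tightness from the moments + the supersolution `k₊`),
the lower bound is `stub_lowerOfUpper` (bulk mass under the upper envelope + the subsolution `k₋`).
This is the a-priori half of the linear theorem `C⁺` of the line; the composition feeds it the
kernels of the cut-off drifts and passes to the limit with `stub_kernelLimit`.
-/

noncomputable section

open MeasureTheory Set Filter Topology Metric
open scoped ContDiff Laplacian
open Literature.Analysis.FluidPDE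

namespace Summit.NavierStokesRegularity.NavierStokesRegularity.Theorems.AdaptedKernelExists.NashEntropyLastBlock

/-- **A-priori two-sided Gaussian comparability (stubs 2 + 3 of the line).**  For `ν > 0`, `C ≥ 0`
there are `c₁, c₂, C₁, C₂ > 0` such that an adapted backward kernel `G` of a jointly smooth,
divergence-free drift with the Type-I rate `C/√(T−t)` on `Ico t₀ T`, having a Gaussian envelope
and the exponential moment bound `∫ e^{⟨α, x−x₀⟩} G(t,x) dx ≤ exp(ν‖α‖²(T−t) + 2C‖α‖√(T−t))`,
satisfies `c₁ (T−t)^{-3/2} e^{−‖x−x₀‖²/(c₂(T−t))} ≤ G(t,x) ≤ C₁ (T−t)^{-3/2} e^{−‖x−x₀‖²/(C₂(T−t))}`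
on `Ioo t₀ T`. -/
theorem stub_aprioriTwoSided :
    ∀ (ν C : ℝ), 0 < ν → 0 ≤ C → ∃ c₁ c₂ C₁ C₂ : ℝ, 0 < c₁ ∧ 0 < c₂ ∧ 0 < C₁ ∧ 0 < C₂ ∧
      ∀ (t₀ T : ℝ) (b : ℝ → EuclideanSpace ℝ (Fin 3) → EuclideanSpace ℝ (Fin 3))
        (x₀ : EuclideanSpace ℝ (Fin 3)) (G : ℝ → EuclideanSpace ℝ (Fin 3) → ℝ), t₀ < T →
        IsSmoothSpaceTimeOn (Ico t₀ T) b →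
        (∀ t ∈ Ico t₀ T, VectorCalculus.IsDivFree (b t)) →
        (∀ t ∈ Ico t₀ T, ∀ x, ‖b t x‖ ≤ C / Real.sqrt (T - t)) →
        IsAdaptedBackwardKernel ν b (Ico t₀ T) T x₀ G →
        (∃ K a : ℝ, 0 < a ∧ ∀ t ∈ Ioo t₀ T, ∀ x,
          G t x ≤ K * (T - t) ^ (-(3:ℝ) / 2) * Real.exp (-(‖x - x₀‖ ^ 2) / (a * (T - t)))) →
        (∀ (α : EuclideanSpace ℝ (Fin 3)), ∀ t ∈ Ioo t₀ T,
          Integrable (fun x => Real.exp (inner ℝ α (x - x₀)) * G t x) ∧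
          ∫ x, Real.exp (inner ℝ α (x - x₀)) * G t x ≤
            Real.exp (ν * ‖α‖ ^ 2 * (T - t) + 2 * C * ‖α‖ * Real.sqrt (T - t))) →
        (∀ t ∈ Ioo t₀ T, ∀ x,
          c₁ * (T - t) ^ (-(3:ℝ) / 2) * Real.exp (-(‖x - x₀‖ ^ 2) / (c₂ * (T - t))) ≤ G t x) ∧
        (∀ t ∈ Ioo t₀ T, ∀ x,
          G t x ≤ C₁ * (T - t) ^ (-(3:ℝ) / 2) * Real.exp (-(‖x - x₀‖ ^ 2) / (C₂ * (T - t)))) := by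
  intro ν C hν hC
  obtain ⟨C₁, C₂, hC₁, hC₂, hup⟩ := stub_upperOfMoments ν C hν hC
  obtain ⟨c₁, c₂, hc₁, hc₂, hlow⟩ := stub_lowerOfUpper ν C C₁ C₂ hν hC hC₁ hC₂
  refine ⟨c₁, c₂, C₁, C₂, hc₁, hc₂, hC₁, hC₂, ?_⟩
  intro t₀ T b x₀ G ht₀ hsm hdiv hrate hK henv hmom
  have hU := hup t₀ T b x₀ G ht₀ hsm hdiv hrate hK henv hmom
  exact ⟨hlow t₀ T b x₀ G ht₀ hsm hdiv hrate hK hU, hU⟩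

end Summit.NavierStokesRegularity.NavierStokesRegularity.Theorems.AdaptedKernelExists.NashEntropyLastBlock

end
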